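import Mathlib.NumberTheory.NumberField.Basic
import Mathlib.Data.ZMod.Basic
import Mathlib.RingTheory.DedekindDomain.Factorization
import Literature.NumberTheory.GaloisRepresentations.ChebotarevRestrict
import HarnessLib

/-!
# A nontrivial automorphism of a number field moves some prime

Mochizuki, *The geometry of Frobenioids I*, Kyushu J. Math. **62** (2008), proof of Thm. 6.4 (i), kurims
text p. 115: "since any automorphism of a number field that fixes all of the valuations of the number
field is clearly equal to the identity automorphism, it follows immediately that `Φ` is non-dilating, and
that `D` is Div-slim". [cite: MochizukiFrdI2008, Thm. 6.4 (i) p.115]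

PROVED here (discharge seat abc-iut-L6-t10, D-ζ-c; the number-theoretic input of the Div-slim clause of
Thm. 6.4 (i)): for a number field `L` and a ring automorphism `σ ≠ id` of `L`, some maximal ideal `v` of
`𝓞 L` satisfies `σ(v) ≠ v`. Proof: pick `x ∈ 𝓞 L` with `σ x ≠ x`; among the infinitely many primes `v`
of `L` of prime absolute norm (degree one; the tree's Chebotarev theorem
`infinite_setOf_prime_absNorm_frobenius_restrict_eq` with `T = ⊥`) choose one not dividing `σ x - x`;
if `σ(v) = v`, then `σ` induces a ring endomorphism of `𝓞 L / v ≅ 𝔽_p`, necessarily the identity, so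
`σ x - x ∈ v` — contradiction. Mathlib-level statement; no Frobenioid vocabulary.
-/

namespace Literature.NumberTheory.NumberFields

open NumberField IsDedekindDomain

/-- A ring endomorphism of a ring of prime cardinality is the identity (`R ≅ ℤ/p`). [folklore] -/
private theorem ringHom_eq_id_of_card_prime {R : Type*} [CommRing R] [Fintype R] {p : ℕ} (hp : p.Prime)
    (hR : Fintype.card R = p) (τ : R →+* R) : τ = RingHom.id R := by
  let e : ZMod p ≃+* R := ZMod.ringEquivOfPrime R hp hR
  have h : τ.comp e.toRingHom = e.toRingHom := Subsingleton.elim _ _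
  refine RingHom.ext fun z => ?_
  obtain ⟨a, rfl⟩ := e.surjective z
  have := RingHom.congr_fun h a
  simpa using this

/-- **A nontrivial automorphism of a number field moves some prime** ("any automorphism of a number
field that fixes all of the valuations of the number field is clearly equal to the identity
automorphism", FrdI p. 115 — here for the finite places): if `σ : L ≃+* L` is not the identity, some
maximal ideal `v` of `𝓞 L` has `σ(v) ≠ v`. [cite: MochizukiFrdI2008, Thm. 6.4 (i) p.115] -/
theorem exists_map_heightOneSpectrum_ne {L : Type} [Field L] [NumberField L] (σ : L ≃+* L)
    (hσ : σ ≠ RingEquiv.refl L) :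
    ∃ v : HeightOneSpectrum (𝓞 L),
      Ideal.map (RingOfIntegers.mapRingEquiv σ) v.asIdeal ≠ v.asIdeal := by
  classical
  set σ' : 𝓞 L ≃+* 𝓞 L := RingOfIntegers.mapRingEquiv σ with hσ'
  -- an integer moved by `σ`
  have hσL : ∀ z : 𝓞 L, ((σ' z : 𝓞 L) : L) = σ (z : L) := fun z => RingOfIntegers.mapRingEquiv_apply σ z
  obtain ⟨x, hx⟩ : ∃ x : 𝓞 L, σ' x ≠ x := by
    by_contra h
    push Not at h
    apply hσ
    ext y
    obtain ⟨a, b, -, rfl⟩ := IsFractionRing.div_surjective (A := 𝓞 L) y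
    have ha : σ (a : L) = a := by rw [← hσL, h a]
    have hb : σ (b : L) = b := by rw [← hσL, h b]
    show σ (algebraMap (𝓞 L) L a / algebraMap (𝓞 L) L b) = algebraMap (𝓞 L) L a / algebraMap (𝓞 L) L b
    rw [map_div₀]
    exact congrArg₂ (· / ·) ha hb
  set d : 𝓞 L := σ' x - x with hd
  have hd0 : d ≠ 0 := sub_ne_zero.mpr hx
  -- infinitely many primes of degree one (Chebotarev with `T = ⊥`, `g = 1`)
  have hinf : {v : HeightOneSpectrum (𝓞 L) | (Ideal.absNorm v.asIdeal).Prime}.Infinite :=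
    (GaloisRepresentations.infinite_setOf_prime_absNorm_frobenius_restrict_eq
      (F := L) (⊥ : IntermediateField L (AlgebraicClosure L)) 1).mono fun v hv => hv.1
  -- finitely many primes divide `d`
  have hfin : {v : HeightOneSpectrum (𝓞 L) | v.asIdeal ∣ Ideal.span {d}}.Finite :=
    Ideal.finite_factors (by simpa [Ideal.span_singleton_eq_bot] using hd0)
  obtain ⟨v, hvp, hvd⟩ := (hinf.sdiff hfin).nonempty
  refine ⟨v, fun hfix => hvd ?_⟩
  -- `σ` induces a ring endomorphism of the residue field `𝓞 L / v`, of prime cardinality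
  let f : 𝓞 L →+* 𝓞 L := σ'.toRingHom
  have hmap : Ideal.map f v.asIdeal = v.asIdeal := hfix
  have hle : v.asIdeal ≤ Ideal.comap f v.asIdeal :=
    calc v.asIdeal ≤ Ideal.comap f (Ideal.map f v.asIdeal) := Ideal.le_comap_map
      _ = Ideal.comap f v.asIdeal := by rw [hmap]
  let τ : 𝓞 L ⧸ v.asIdeal →+* 𝓞 L ⧸ v.asIdeal := Ideal.quotientMap v.asIdeal f hle
  have hcard : Nat.card (𝓞 L ⧸ v.asIdeal) = Ideal.absNorm v.asIdeal := by
    rw [Ideal.absNorm_apply, Submodule.cardQuot_apply]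
  haveI : Finite (𝓞 L ⧸ v.asIdeal) := Nat.finite_of_card_ne_zero (by rw [hcard]; exact hvp.ne_zero)
  letI : Fintype (𝓞 L ⧸ v.asIdeal) := Fintype.ofFinite _
  have hcard' : Fintype.card (𝓞 L ⧸ v.asIdeal) = Ideal.absNorm v.asIdeal := by
    rw [Fintype.card_eq_nat_card, hcard]
  have hτ : τ = RingHom.id _ := ringHom_eq_id_of_card_prime hvp hcard' τ
  have key : Ideal.Quotient.mk v.asIdeal (f x) = Ideal.Quotient.mk v.asIdeal x := by
    have := RingHom.congr_fun hτ (Ideal.Quotient.mk v.asIdeal x)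
    rwa [Ideal.quotientMap_mk, RingHom.id_apply] at this
  rw [Ideal.Quotient.eq] at key
  exact Ideal.dvd_span_singleton.mpr key

end Literature.NumberTheory.NumberFields
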